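import Mathlib.GroupTheory.SpecificGroups.Dihedral
import Mathlib.GroupTheory.SpecificGroups.KleinFour
import Mathlib.Algebra.Group.Commutator
import Mathlib.GroupTheory.Abelianization.Defs
import Mathlib.GroupTheory.Perm.Cycle.Type
import HarnessLib

/-!
# The derived subgroup and the abelianization of a dihedral group

For the dihedral group `D_n = DihedralGroup n` (of order `2n`; `n = 0` is the infinite dihedral
group), with rotations `r i` and reflections `sr i` (`i : ZMod n`):

* `commutatorElement_r_r/_r_sr/_sr_r/_sr_sr` — the four commutators of generators, e.g.
  `⁅r i, sr j⁆ = r (2i)`;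
* `commutator_dihedralGroup` — **`[D_n, D_n] = ⟨r 2⟩`**, the rotations by even angles;
* `mul_self_mem_commutator_dihedralGroup`, `sr_not_mem_commutator_dihedralGroup` — every square
  is a commutator, no reflection is;
* hence the abelianization `D_n^{ab}` is an elementary abelian `2`-group
  (`abelianization_mul_self`, `exponent_abelianization_dihedralGroup : exponent = 2`) of order `2`
  or `4` (`card_abelianization_dihedralGroup`), i.e. **`D_n^{ab} ≅ ℤ/2ℤ` or `(ℤ/2ℤ)²`**
  (`card_abelianization_eq_two_or_isKleinFour`; order `2` for `n` odd, `4` for `n` even or `0`).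

This is the group theory behind the sentence *"For any `(i, j)`, the abelianization of the
projective image of `ρ_{i,j}` is isomorphic either to `ℤ/2ℤ` or `(ℤ/2ℤ)²"* in the proof of
Prop. 3.9 of Newton–Thorne, *Symmetric power functoriality for holomorphic modular forms, II*
(p. 25 of arXiv:2009.07180): the projective image of an irreducible dihedral (= induced from an
index-`2` subgroup) two-dimensional representation is a dihedral group.

Mathlib (`Mathlib/GroupTheory/SpecificGroups/Dihedral.lean`) has the multiplication table,
orders of elements, exponent, centre (odd `n`) and `IsKleinFour (DihedralGroup 2)`, but not the
derived subgroup or the abelianization (`lean search` for `DihedralGroup` with `commutator` /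
`Abelianization`: no hits).

## References

* [folklore] (e.g. any treatment of `D_n`; `[D_n, D_n] = ⟨r²⟩`).
* J. Newton, J. A. Thorne, *Symmetric power functoriality for holomorphic modular forms, II*,
  Publ. Math. IHÉS 134 (2021), proof of Prop. 3.9 (arXiv:2009.07180, p. 25) [NewtonThorneIHES2021b].
-/

namespace Literature.GroupTheory.SpecificGroups

open DihedralGroup

open scoped commutatorElement

variable {n : ℕ}

/-! ### Commutators of the generators -/

/-- `⁅r i, r j⁆ = 1`. [folklore] -/
theorem commutatorElement_r_r (i j : ZMod n) : ⁅r i, r j⁆ = 1 := by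
  simp only [commutatorElement_def, inv_r, r_mul_r]
  rw [show i + j + -i + -j = 0 by ring, r_zero]

/-- `⁅r i, sr j⁆ = r (2i)`. [folklore] -/
theorem commutatorElement_r_sr (i j : ZMod n) : ⁅r i, sr j⁆ = r (2 * i) := by
  simp only [commutatorElement_def, inv_r, inv_sr, r_mul_sr, sr_mul_r, sr_mul_sr]
  congr 1
  ring

/-- `⁅sr i, r j⁆ = r (−2j)`. [folklore] -/
theorem commutatorElement_sr_r (i j : ZMod n) : ⁅sr i, r j⁆ = r (2 * -j) := by
  simp only [commutatorElement_def, inv_r, inv_sr, sr_mul_r, sr_mul_sr, r_mul_r]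
  congr 1
  ring

/-- `⁅sr i, sr j⁆ = r (2(j − i))`. [folklore] -/
theorem commutatorElement_sr_sr (i j : ZMod n) : ⁅sr i, sr j⁆ = r (2 * (j - i)) := by
  simp only [commutatorElement_def, inv_sr, sr_mul_sr, r_mul_sr]
  congr 1
  ring

/-- `r (2i) ∈ ⟨r 2⟩`. [folklore] -/
theorem r_two_mul_mem_zpowers (i : ZMod n) :
    r (2 * i) ∈ Subgroup.zpowers (r (2 : ZMod n)) := by
  rw [Subgroup.mem_zpowers_iff]
  exact ⟨(i.cast : ℤ), by rw [r_zpow, ZMod.intCast_zmod_cast]⟩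

/-! ### The derived subgroup -/

/-- **`[D_n, D_n] = ⟨r 2⟩`**: the derived subgroup of the dihedral group is generated by the
rotation `r 2` (for every `n`, including the infinite dihedral group `n = 0`). [folklore] -/
theorem commutator_dihedralGroup (n : ℕ) :
    commutator (DihedralGroup n) = Subgroup.zpowers (r (2 : ZMod n)) := by
  apply le_antisymm
  · rw [commutator_def, Subgroup.commutator_le]
    rintro a - b -
    rcases a with i | i <;> rcases b with j | j
    · rw [commutatorElement_r_r]
      exact one_mem _
    · rw [commutatorElement_r_sr]
      exact r_two_mul_mem_zpowers i
    · rw [commutatorElement_sr_r]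
      exact r_two_mul_mem_zpowers (-j)
    · rw [commutatorElement_sr_sr]
      exact r_two_mul_mem_zpowers (j - i)
  · rw [Subgroup.zpowers_le]
    have h := commutatorElement_r_sr (1 : ZMod n) 0
    rw [mul_one] at h
    rw [← h, commutator_def]
    exact Subgroup.commutator_mem_commutator (Subgroup.mem_top _) (Subgroup.mem_top _)

/-- Every square lies in the derived subgroup: `(r i)² = r (2i)`, `(sr i)² = 1`. [folklore] -/
theorem mul_self_mem_commutator_dihedralGroup (g : DihedralGroup n) :
    g * g ∈ commutator (DihedralGroup n) := by
  rw [commutator_dihedralGroup]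
  rcases g with i | i
  · rw [r_mul_r, ← two_mul]
    exact r_two_mul_mem_zpowers i
  · rw [sr_mul_self]
    exact one_mem _

/-- No reflection is a product of commutators. [folklore] -/
theorem sr_not_mem_commutator_dihedralGroup (i : ZMod n) :
    sr i ∉ commutator (DihedralGroup n) := by
  rw [commutator_dihedralGroup, Subgroup.mem_zpowers_iff]
  rintro ⟨k, hk⟩
  rw [r_zpow] at hk
  cases hk

/-! ### The abelianization -/

/-- Every element of `D_n^{ab}` squares to `1`. [folklore] -/
theorem abelianization_mul_self (x : Abelianization (DihedralGroup n)) : x * x = 1 := by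
  have hsurj : Function.Surjective (Abelianization.of : DihedralGroup n → _) :=
    QuotientGroup.mk_surjective
  obtain ⟨g, rfl⟩ := hsurj x
  rw [← map_mul, ← MonoidHom.mem_ker, Abelianization.ker_of]
  exact mul_self_mem_commutator_dihedralGroup g

/-- `D_n^{ab}` is non-trivial: the image of a reflection is not `1`. [folklore] -/
theorem abelianization_of_sr_ne_one (i : ZMod n) :
    Abelianization.of (sr i : DihedralGroup n) ≠ 1 := by
  rw [Ne, ← MonoidHom.mem_ker, Abelianization.ker_of]
  exact sr_not_mem_commutator_dihedralGroup i

/-- `D_n^{ab}` is non-trivial. [folklore] -/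
instance : Nontrivial (Abelianization (DihedralGroup n)) :=
  ⟨⟨Abelianization.of (sr 0), 1, abelianization_of_sr_ne_one 0⟩⟩

/-- **`exponent (D_n^{ab}) = 2`.** [folklore] -/
theorem exponent_abelianization_dihedralGroup (n : ℕ) :
    Monoid.exponent (Abelianization (DihedralGroup n)) = 2 := by
  have hdvd : Monoid.exponent (Abelianization (DihedralGroup n)) ∣ 2 := by
    rw [Monoid.exponent_dvd_iff_forall_pow_eq_one]
    intro g
    rw [pow_two, abelianization_mul_self]
  rcases (Nat.dvd_prime Nat.prime_two).mp hdvd with h | h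
  · exact absurd (Monoid.exp_eq_one_iff.mp h) (not_subsingleton _)
  · exact h

/-- The image of a rotation in `D_n^{ab}` is `1` or the image of `r 1` (write the angle as
`2k` or `2k + 1`). [folklore] -/
theorem abelianization_of_r (i : ZMod n) :
    Abelianization.of (r i : DihedralGroup n) = 1 ∨
      Abelianization.of (r i : DihedralGroup n) = Abelianization.of (r 1) := by
  set z : ℤ := i.cast with hz
  have hi : i = ((2 * (z / 2) + z % 2 : ℤ) : ZMod n) := by
    rw [Int.mul_ediv_add_emod, hz, ZMod.intCast_zmod_cast]
  have heven : Abelianization.of (r (((2 * (z / 2) : ℤ)) : ZMod n) : DihedralGroup n) = 1 := by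
    rw [← MonoidHom.mem_ker, Abelianization.ker_of, commutator_dihedralGroup, Int.cast_mul,
      Int.cast_two]
    exact r_two_mul_mem_zpowers _
  have key : Abelianization.of (r i : DihedralGroup n) =
      Abelianization.of (r (((z % 2 : ℤ)) : ZMod n)) := by
    conv_lhs => rw [hi]
    rw [Int.cast_add, ← r_mul_r, map_mul, heven, one_mul]
  rcases Int.emod_two_eq_zero_or_one z with h | h
  · left
    rw [key, h, Int.cast_zero, r_zero, map_one]
  · right
    rw [key, h, Int.cast_one]

/-- A surjection `Bool × Bool → D_n^{ab}`: `(a, b) ↦ s̄^a r̄^b`. [folklore] -/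
theorem abelianization_surjective_boolProd :
    Function.Surjective fun p : Bool × Bool =>
      ((if p.1 then Abelianization.of (sr 0 : DihedralGroup n) else 1) *
        (if p.2 then Abelianization.of (r 1 : DihedralGroup n) else 1)) := by
  have hsurj : Function.Surjective (Abelianization.of : DihedralGroup n → _) :=
    QuotientGroup.mk_surjective
  intro x
  obtain ⟨g, rfl⟩ := hsurj x
  rcases g with i | i
  · rcases abelianization_of_r i with h | h
    · exact ⟨(false, false), by simp [h]⟩
    · exact ⟨(false, true), by simp [h]⟩
  · have hval : Abelianization.of (sr i : DihedralGroup n) =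
        Abelianization.of (sr 0) * Abelianization.of (r i) := by
      rw [← map_mul, sr_mul_r, zero_add]
    rcases abelianization_of_r i with h | h
    · exact ⟨(true, false), by rw [hval, h]; simp⟩
    · exact ⟨(true, true), by rw [hval, h]; simp⟩

/-- `D_n^{ab}` is finite (a quotient of `Bool × Bool`), also for the infinite dihedral group.
[folklore] -/
instance : Finite (Abelianization (DihedralGroup n)) :=
  Finite.of_surjective _ abelianization_surjective_boolProd

/-- `|D_n^{ab}| ≤ 4`. [folklore] -/
theorem card_abelianization_le_four (n : ℕ) :
    Nat.card (Abelianization (DihedralGroup n)) ≤ 4 := by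
  have h := Nat.card_le_card_of_surjective _ (abelianization_surjective_boolProd (n := n))
  simpa using h

/-- **`|D_n^{ab}| = 2` or `4`** (it is `2` for `n` odd and `4` for `n` even or `n = 0`).
[folklore] -/
theorem card_abelianization_dihedralGroup (n : ℕ) :
    Nat.card (Abelianization (DihedralGroup n)) = 2 ∨
      Nat.card (Abelianization (DihedralGroup n)) = 4 := by
  have h4 := card_abelianization_le_four n
  have h2 : 1 < Nat.card (Abelianization (DihedralGroup n)) := Finite.one_lt_card
  have h3 : Nat.card (Abelianization (DihedralGroup n)) ≠ 3 := by
    intro h3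
    haveI : Fact (Nat.Prime 3) := ⟨Nat.prime_three⟩
    obtain ⟨x, hx⟩ := exists_prime_orderOf_dvd_card' (G := Abelianization (DihedralGroup n)) 3
      (by rw [h3])
    have hdvd : orderOf x ∣ 2 := orderOf_dvd_of_pow_eq_one (by rw [pow_two, abelianization_mul_self])
    rw [hx] at hdvd
    exact absurd (Nat.le_of_dvd two_pos hdvd) (by norm_num)
  omega

/-- **`D_n^{ab} ≅ ℤ/2ℤ` or `(ℤ/2ℤ)²`**: the abelianization of a dihedral group has order `2`, or
is a Klein four-group (order `4`, exponent `2`).  In Newton–Thorne II, proof of Prop. 3.9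
(p. 25): *"the abelianization of the projective image of `ρ_{i,j}` is isomorphic either to `ℤ/2ℤ`
or `(ℤ/2ℤ)²"* (the projective image of an irreducible dihedral representation being a dihedral
group). [cite: NewtonThorneIHES2021b, proof of Prop. 3.9 (p. 25 of arXiv:2009.07180)] -/
theorem card_abelianization_eq_two_or_isKleinFour (n : ℕ) :
    Nat.card (Abelianization (DihedralGroup n)) = 2 ∨
      IsKleinFour (Abelianization (DihedralGroup n)) := by
  rcases card_abelianization_dihedralGroup n with h | h
  · exact Or.inl h
  · exact Or.inr ⟨h, exponent_abelianization_dihedralGroup n⟩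

end Literature.GroupTheory.SpecificGroups
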